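import Summits.HodgeConjecture.CorCM.Census.CentralSquaresBaseInvolutive

/-!
# The square-central class, XXXIV: the ORBIT CORNERS `{T ∣ B}` — a `T₀/T₁` tie resolved by the strict cover EITHER way (dichotomy)

COR-CM (cell `pub-hodgecm2`), count-neutral kernel combinatorics by the binder seat b09 (gen 47; lane SQUARE-CENTRAL CLASS, part XXXIV), on parts
III (`ddist_eq_card_symmDiff`, `bpot_eq_card_dev_of_le`, `unique_T₀_of_lt`), IV (`card_symmDiff_union`, `face_toward_T₀`), V (the frame exchange
`base_cases_exchange`, `card_frame`, `card_sdiff_frame`, `cover_frame`, `sdiff_eq_of_dev`), I (`strict_rt`) and gen 32ʼs restricted star reduction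
`single_sub_thetaG_mem_of`, all BY NAME.  Theorems only: no definition, no `decide`, no certificate, no named fact, no `sorry`.  HONEST FRAMING: `HC_CM`
is NOT proved, here or anywhere in the tree; nothing here is a period or a headline.

THE KERNEL-FOUR ROWS (dihedral quotients `π : G ↠ D₄` with `|ker π| = 4` and no involutive reflection lift; design note `KERNEL-FOUR.md` of gen 47).
In the four-type frame `(T₀; T₁)` (`|T₀| = 4m`, `𝓗 = T₀ ∖ T₁` of size `2m`) take `T ⊆ 𝓗` with `|T| = m` and `B ⊆ T₀ ∖ 𝓗 = T₀ ∩ T₁` with `|B| < m`.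
The type `X = {T ∣ B}` (deviation set `T ∪ B`) is at distance `m + |B|` from BOTH `T₀` and `T₁` and farther from their complements: a two-way tie.
Every type strictly below it on the `T₀`-side (`D ⊆ T ∪ B`, `T ⊄ D`) has `T₀` as its UNIQUE nearest base change (§1), so `X` carries strict lowering
triples toward `T₀` (two places of `T`) and, symmetrically, toward `T₁` (two places of `c·(𝓗 ∖ T)`), and NO strict triple through a place of `B`
(such a corner is again a tie).  Hence the face of a strict lowering cover at `X` goes toward `T₀` with both places in `T`, or toward `T₁` with both
places in `c·(𝓗 ∖ T)` (§2 `orbit_corner_face_cases`), and accordingly (§3 **`single_sub_thetaG_mem_or_of_orbit_corner`**)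
`[X] − θ_{T₀}(typeSum [X]) ∈ L` OR `[X] − θ_{T₁}(typeSum [X]) ∈ L` — the DICHOTOMY at the corners `{T ∣ A ∖ a}` (`|B| = 3`) and
`{T ∣ σ²a, σ³a}` (`|B| = 2`) of the designated orbit face of part XXXV (`m = 4`).  No transversality of `T` and no involution is used; the `T₁`-side
is the `T₀`-side in the exchanged frame `(T₁; T₀)` of part V.

## References
* [Pohlmann1968] H. Pohlmann, Algebraic cycles on abelian varieties of complex multiplication type, Ann. of Math. 88 (1968), Thm 1.
-/

namespace Summit.HodgeConjecture.CorCM.Census.CentralSquares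

open Finset
open scoped symmDiff
open Summit.HodgeConjecture.CorCM.Prior.AllgGroup.RfwfAllgGroup
open Summit.HodgeConjecture.CorCM.Census.BlockParity
open Summit.HodgeConjecture.CorCM.Census.Coinvariant
open Summit.HodgeConjecture.CorCM.Census.TwistGeneration
open Summit.HodgeConjecture.CorCM.Census.BaseBlock
open Summit.HodgeConjecture.CorCM.Census.CoverClosure

noncomputable section

variable {G : Type*} [Group G] [Fintype G] [DecidableEq G] (c : G)

section Frame

variable (hc2 : c * c = 1) (hcen : ∀ x : G, x * c = c * x) (T₀ T₁ : CMF G c)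
variable (hbase : ∀ Q : G, rt c Q T₀ = T₀ ∨ rt c Q T₀ = rt c c T₀ ∨ rt c Q T₀ = T₁ ∨ rt c Q T₀ = rt c c T₁)
variable (m : ℕ) (hn : T₀.1.card = 4 * m) (hH : (T₀.1 \ T₁.1).card = 2 * m)
variable (Q : G) (hQ : rt c Q T₀ = T₁)
variable (L : Submodule ℤ (CMF G c →₀ ℤ)) (hLrt : ∀ (Q' : G) (y : CMF G c →₀ ℤ), y ∈ L → Finsupp.mapDomain (rt c Q') y ∈ L)
variable (hcover : ∀ Ψ : CMF G c, 2 ≤ bpot c T₀ Ψ → ∃ Q₂ s s' : G, bpot c T₀ Ψ = ddist (rt c Q₂ T₀) Ψ ∧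
    s ∈ (rt c Q₂ T₀).1 \ Ψ.1 ∧ s' ∈ (rt c Q₂ T₀).1 \ Ψ.1 ∧ s ≠ s' ∧
    gface c hc2 Ψ s s' ∈ L ∧
    ((∃ Q₁ t t' : G, bpot c T₀ Ψ = ddist (rt c Q₁ T₀) Ψ ∧ t ∈ (rt c Q₁ T₀).1 \ Ψ.1 ∧ t' ∈ (rt c Q₁ T₀).1 \ Ψ.1 ∧ t ≠ t' ∧
        (∀ Q' : G, ddist (rt c Q' T₀) (oflipCM c hc2 t Ψ) = bpot c T₀ (oflipCM c hc2 t Ψ) → rt c Q' T₀ = rt c Q₁ T₀) ∧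
        (∀ Q' : G, ddist (rt c Q' T₀) (oflipCM c hc2 t' Ψ) = bpot c T₀ (oflipCM c hc2 t' Ψ) → rt c Q' T₀ = rt c Q₁ T₀) ∧
        (∀ Q' : G, ddist (rt c Q' T₀) (oflipCM c hc2 t (oflipCM c hc2 t' Ψ)) = bpot c T₀ (oflipCM c hc2 t (oflipCM c hc2 t' Ψ)) →
          rt c Q' T₀ = rt c Q₁ T₀)) →
      (∀ Q' : G, ddist (rt c Q' T₀) (oflipCM c hc2 s Ψ) = bpot c T₀ (oflipCM c hc2 s Ψ) → rt c Q' T₀ = rt c Q₂ T₀) ∧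
      (∀ Q' : G, ddist (rt c Q' T₀) (oflipCM c hc2 s' Ψ) = bpot c T₀ (oflipCM c hc2 s' Ψ) → rt c Q' T₀ = rt c Q₂ T₀) ∧
      (∀ Q' : G, ddist (rt c Q' T₀) (oflipCM c hc2 s (oflipCM c hc2 s' Ψ)) = bpot c T₀ (oflipCM c hc2 s (oflipCM c hc2 s' Ψ)) →
        rt c Q' T₀ = rt c Q₂ T₀)))

/-! ## §1 Below an orbit corner: unique nearest base change `T₀` -/

include hc2 hcen hbase hn hH in
/-- **Strictly below `{T ∣ B}` the nearest base change is `T₀`, uniquely.**  `T ⊆ 𝓗` with `|T| = m`, `B ⊆ T₀ ∖ 𝓗` with `|B| < m`; a type `X` with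
`D(X) ⊆ T ∪ B` and `T ⊄ D(X)` has `bpot X = |D(X)|` and `T₀` as its only nearest base change. [folklore] -/
theorem unique_T₀_below_orbit_corner (T B : Finset G) (hTH : T ⊆ T₀.1 \ T₁.1) (hTm : T.card = m)
    (hB : B ⊆ T₀.1 \ (T₀.1 \ T₁.1)) (hBm : B.card < m) (X : CMF G c) (hX : T₀.1 \ X.1 ⊆ T ∪ B) (hXT : ¬ T ⊆ T₀.1 \ X.1) :
    bpot c T₀ X = (T₀.1 \ X.1).card ∧
      ∀ Q' : G, ddist (rt c Q' T₀) X = bpot c T₀ X → rt c Q' T₀ = rt c (1 : G) T₀ := by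
  set D := T₀.1 \ X.1 with hDdef
  have hBdisj : Disjoint B (T₀.1 \ T₁.1) := by
    rw [disjoint_iff_ne]; rintro x hx y hy rfl; exact (mem_sdiff.mp (hB hx)).2 hy
  have hTB : Disjoint T B := by
    rw [disjoint_iff_ne]; rintro x hx y hy rfl; exact (mem_sdiff.mp (hB hy)).2 (hTH hx)
  have hdecomp : D = (D ∩ T) ∪ (D ∩ B) := by
    ext x; simp only [mem_union, mem_inter]
    constructor
    · intro hx; rcases mem_union.mp (hX hx) with h | h
      · exact Or.inl ⟨hx, h⟩
      · exact Or.inr ⟨hx, h⟩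
    · rintro (⟨h, -⟩ | ⟨h, -⟩) <;> exact h
  have hS : D ∩ T ⊆ T := inter_subset_right
  have hB' : D ∩ B ⊆ B := inter_subset_right
  have hSm : (D ∩ T).card < m := by
    rw [← hTm]
    refine card_lt_card (Finset.ssubset_iff_subset_ne.mpr ⟨hS, fun h => hXT ?_⟩)
    rw [← h]; exact inter_subset_left
  have hB'm : (D ∩ B).card < m := (card_le_card hB').trans_lt hBm
  have hdisj : Disjoint (D ∩ T) (D ∩ B) := disjoint_of_subset_left hS (disjoint_of_subset_right hB' hTB)
  have hDcard : D.card = (D ∩ T).card + (D ∩ B).card := by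
    conv_lhs => rw [hdecomp]
    rw [card_union_of_disjoint hdisj]
  have hsd : ((T₀.1 \ T₁.1) ∆ D).card = 2 * m - (D ∩ T).card + (D ∩ B).card := by
    conv_lhs => rw [hdecomp]
    rw [card_symmDiff_union _ (D ∩ T) (D ∩ B) (hS.trans hTH) (disjoint_of_subset_left hB' hBdisj), hH]
  have h1 : D.card < T₀.1.card - D.card := by rw [hn, hDcard]; omega
  have h2 : D.card < ((T₀.1 \ T₁.1) ∆ D).card := by rw [hsd, hDcard]; omega
  have h3 : D.card < T₀.1.card - ((T₀.1 \ T₁.1) ∆ D).card := by rw [hsd, hn, hDcard]; omega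
  exact ⟨bpot_eq_card_dev_of_le c T₀ T₁ hbase hc2 hcen X h1.le h2.le h3.le, unique_T₀_of_lt c T₀ T₁ hbase hc2 hcen X h1 h2 h3⟩

include hc2 hcen hbase hn hH in
/-- **The orbit corner `{T ∣ B}` is a `T₀/T₁` tie at potential `m + |B|`**: `bpot X = |D(X)| = m + |B| = ddist T₁ X`. [folklore] -/
theorem bpot_orbit_corner (T B : Finset G) (hTH : T ⊆ T₀.1 \ T₁.1) (hTm : T.card = m)
    (hB : B ⊆ T₀.1 \ (T₀.1 \ T₁.1)) (hBm : B.card < m) (X : CMF G c) (hX : T₀.1 \ X.1 = T ∪ B) :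
    bpot c T₀ X = m + B.card ∧ (T₀.1 \ X.1).card = m + B.card ∧ ((T₀.1 \ T₁.1) ∆ (T₀.1 \ X.1)).card = m + B.card := by
  have hBdisj : Disjoint B (T₀.1 \ T₁.1) := by
    rw [disjoint_iff_ne]; rintro x hx y hy rfl; exact (mem_sdiff.mp (hB hx)).2 hy
  have hTB : Disjoint T B := by
    rw [disjoint_iff_ne]; rintro x hx y hy rfl; exact (mem_sdiff.mp (hB hy)).2 (hTH hx)
  have hcardD : (T₀.1 \ X.1).card = m + B.card := by rw [hX, card_union_of_disjoint hTB, hTm]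
  have hsd : ((T₀.1 \ T₁.1) ∆ (T₀.1 \ X.1)).card = m + B.card := by
    rw [hX, card_symmDiff_union _ T B hTH hBdisj, hH, hTm]; omega
  refine ⟨?_, hcardD, hsd⟩
  rw [← hcardD]
  refine bpot_eq_card_dev_of_le c T₀ T₁ hbase hc2 hcen X ?_ ?_ ?_
  · rw [hn, hcardD]; omega
  · rw [hsd, hcardD]
  · rw [hn, hsd, hcardD]; omega

/-! ## §2 The star normal form toward `T₀`, given a face with both places in `T` -/

include hcen hbase hn hH hcover in
/-- **STAR NORMAL FORM AT AN ORBIT CORNER, `T₀`-DIRECTION.**  `T ⊆ 𝓗`, `|T| = m`, `B ⊆ T₀ ∖ 𝓗`, `|B| < m`.  If `L` holds, through the type with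
deviation set `T ∪ B`, a face at two distinct places of `T`, then every type `Y` with `D(Y) ⊆ T ∪ B` and (`D(Y) = T ∪ B` or `T ⊄ D(Y)`) satisfies
`[Y] − θ_{T₀}(typeSum [Y]) ∈ L`. [folklore] -/
theorem single_sub_thetaG_mem_orbit_corner_of_face (T B : Finset G) (hTH : T ⊆ T₀.1 \ T₁.1) (hTm : T.card = m)
    (hB : B ⊆ T₀.1 \ (T₀.1 \ T₁.1)) (hBm : B.card < m)
    (hface : ∀ X : CMF G c, T₀.1 \ X.1 = T ∪ B → ∃ s s' : G, s ∈ T ∧ s' ∈ T ∧ s ≠ s' ∧ gface c hc2 X s s' ∈ L) :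
    ∀ Y : CMF G c, (T₀.1 \ Y.1 ⊆ T ∪ B ∧ (T₀.1 \ Y.1 = T ∪ B ∨ ¬ T ⊆ T₀.1 \ Y.1)) →
      Finsupp.single Y 1 - thetaG c hc2 T₀ (typeSum G c (Finsupp.single Y 1)) ∈ L := by
  refine single_sub_thetaG_mem_of c T₀ (fun Y => T₀.1 \ Y.1 ⊆ T ∪ B ∧ (T₀.1 \ Y.1 = T ∪ B ∨ ¬ T ⊆ T₀.1 \ Y.1)) hc2 L fun Y hY h2 => ?_
  obtain ⟨hYsub, hYor⟩ := hY
  -- corners of a face at deviation places stay in the class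
  have hcornerU : ∀ s ∈ T₀.1 \ Y.1, s ∈ T → (T₀.1 \ (oflipCM c hc2 s Y).1 ⊆ T ∪ B ∧
      (T₀.1 \ (oflipCM c hc2 s Y).1 = T ∪ B ∨ ¬ T ⊆ T₀.1 \ (oflipCM c hc2 s Y).1)) := by
    intro s hs hsT
    rw [dev_oflip c hc2 (mem_sdiff.mp hs).1 (mem_sdiff.mp hs).2]
    exact ⟨(erase_subset _ _).trans hYsub, Or.inr fun h => (notMem_erase s _) (h hsT)⟩
  have hcornerU' : ∀ s ∈ T₀.1 \ Y.1, ¬ T ⊆ T₀.1 \ Y.1 → (T₀.1 \ (oflipCM c hc2 s Y).1 ⊆ T ∪ B ∧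
      (T₀.1 \ (oflipCM c hc2 s Y).1 = T ∪ B ∨ ¬ T ⊆ T₀.1 \ (oflipCM c hc2 s Y).1)) := by
    intro s hs hnT
    rw [dev_oflip c hc2 (mem_sdiff.mp hs).1 (mem_sdiff.mp hs).2]
    exact ⟨(erase_subset _ _).trans hYsub, Or.inr fun h => hnT (h.trans (erase_subset _ _))⟩
  have hmem_flip : ∀ s ∈ T₀.1 \ Y.1, ∀ s' ∈ T₀.1 \ Y.1, s ≠ s' → s ∈ T₀.1 \ (oflipCM c hc2 s' Y).1 := by
    intro s hs s' hs' hss'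
    rw [dev_oflip c hc2 (mem_sdiff.mp hs').1 (mem_sdiff.mp hs').2]; exact mem_erase.mpr ⟨hss', hs⟩
  rcases hYor with hYeq | hnT
  · -- the top type: the supplied face at two places of `T`
    obtain ⟨s, s', hsT, hs'T, hss', hmem⟩ := hface Y hYeq
    have hs : s ∈ T₀.1 \ Y.1 := by rw [hYeq]; exact mem_union_left _ hsT
    have hs' : s' ∈ T₀.1 \ Y.1 := by rw [hYeq]; exact mem_union_left _ hs'T
    refine ⟨s, s', hs, hs', hss', hmem, hcornerU s hs hsT, hcornerU s' hs' hs'T, ?_⟩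
    have hs'' : s ∈ T₀.1 \ (oflipCM c hc2 s' Y).1 := hmem_flip s hs s' hs' hss'
    obtain ⟨h1, _⟩ := hcornerU s' hs' hs'T
    rw [dev_oflip c hc2 (mem_sdiff.mp hs'').1 (mem_sdiff.mp hs'').2]
    exact ⟨(erase_subset _ _).trans h1, Or.inr fun h => (notMem_erase s _) (h hsT)⟩
  · -- strictly below: unique nearest base change `T₀`, the cover face is toward `T₀`
    obtain ⟨hbp, huniq⟩ := unique_T₀_below_orbit_corner c hc2 hcen T₀ T₁ hbase m hn hH T B hTH hTm hB hBm Y hYsub hnT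
    obtain ⟨s, s', hs, hs', hss', hmem⟩ := face_toward_T₀ c hc2 T₀ L hcover Y (by rw [hbp]; exact h2) huniq
    refine ⟨s, s', hs, hs', hss', hmem, hcornerU' s hs hnT, hcornerU' s' hs' hnT, ?_⟩
    have hs'' : s ∈ T₀.1 \ (oflipCM c hc2 s' Y).1 := hmem_flip s hs s' hs' hss'
    obtain ⟨h1, h2'⟩ := hcornerU' s' hs' hnT
    rw [dev_oflip c hc2 (mem_sdiff.mp hs'').1 (mem_sdiff.mp hs'').2]
    refine ⟨(erase_subset _ _).trans h1, Or.inr fun h => ?_⟩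
    rcases h2' with h2' | h2'
    · exfalso; apply hnT
      have hT' : T ⊆ T₀.1 \ (oflipCM c hc2 s' Y).1 := by rw [h2']; exact subset_union_left
      rw [dev_oflip c hc2 (mem_sdiff.mp hs').1 (mem_sdiff.mp hs').2] at hT'
      exact hT'.trans (erase_subset _ _)
    · exact h2' (h.trans (erase_subset _ _))

/-! ## §3 The cover face at an orbit corner: strict, toward `T₀` inside `T` or toward `T₁` inside `c·(𝓗 ∖ T)` -/

include hc2 hcen hbase hn hH hQ in
/-- **No strict triple through a place of `B`.**  For `b ∈ B` the corner `X^{(b)}` of `X = {T ∣ B}` is again a `T₀/T₁` tie, so no base change is its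
unique nearest one. [folklore] -/
theorem not_unique_orbit_corner_flip (hm : 1 ≤ m) (T B : Finset G) (hTH : T ⊆ T₀.1 \ T₁.1) (hTm : T.card = m)
    (hB : B ⊆ T₀.1 \ (T₀.1 \ T₁.1)) (hBm : B.card < m) (X : CMF G c) (hX : T₀.1 \ X.1 = T ∪ B) {b : G} (hb : b ∈ B) (R : CMF G c)
    (hu : ∀ Q' : G, ddist (rt c Q' T₀) (oflipCM c hc2 b X) = bpot c T₀ (oflipCM c hc2 b X) → rt c Q' T₀ = R) : False := by
  have hT₀₁ : T₁ ≠ T₀ := by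
    intro h; rw [h, Finset.sdiff_self, Finset.card_empty] at hH; omega
  have hBdisj : Disjoint B (T₀.1 \ T₁.1) := by
    rw [disjoint_iff_ne]; rintro x hx y hy rfl; exact (mem_sdiff.mp (hB hx)).2 hy
  have hTB : Disjoint T B := by
    rw [disjoint_iff_ne]; rintro x hx y hy rfl; exact (mem_sdiff.mp (hB hy)).2 (hTH hx)
  have hbD : b ∈ T₀.1 \ X.1 := by rw [hX]; exact mem_union_right _ hb
  have hD : T₀.1 \ (oflipCM c hc2 b X).1 = T ∪ B.erase b := by
    rw [dev_oflip c hc2 (mem_sdiff.mp hbD).1 (mem_sdiff.mp hbD).2, hX, erase_union_distrib, erase_eq_of_notMem]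
    exact fun h => (disjoint_left.mp hTB h) hb
  have hcard : (T₀.1 \ (oflipCM c hc2 b X).1).card = m + B.card - 1 := by
    rw [hD, card_union_of_disjoint (disjoint_of_subset_right (erase_subset _ _) hTB), hTm, card_erase_of_mem hb]
    have := card_pos.mpr ⟨b, hb⟩; omega
  have hsd : ((T₀.1 \ T₁.1) ∆ (T₀.1 \ (oflipCM c hc2 b X).1)).card = m + B.card - 1 := by
    rw [hD, card_symmDiff_union _ T _ hTH (disjoint_of_subset_left (erase_subset _ _) hBdisj), hH, hTm, card_erase_of_mem hb]
    have := card_pos.mpr ⟨b, hb⟩; omega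
  have hbp : bpot c T₀ (oflipCM c hc2 b X) = m + B.card - 1 := by
    rw [← hcard]
    refine bpot_eq_card_dev_of_le c T₀ T₁ hbase hc2 hcen _ ?_ ?_ ?_
    · rw [hn, hcard]; omega
    · rw [hsd, hcard]
    · rw [hn, hsd, hcard]; omega
  have h0 := hu 1 (by rw [rt_one, ddist_base_eq, hcard, hbp])
  have h1 := hu Q (by rw [hQ, ddist_eq_card_symmDiff c T₀ hc2, hsd, hbp])
  rw [rt_one] at h0; rw [hQ] at h1
  exact hT₀₁ (h1.trans h0.symm)

include hcen hbase hn hH hQ hcover in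
/-- **THE COVER FACE AT AN ORBIT CORNER.**  For `X = {T ∣ B}` (`T ⊆ 𝓗`, `|T| = m ≥ 2`, `B ⊆ T₀ ∖ 𝓗`, `|B| < m`) the strict lowering cover supplies a
face through `X` in `L` whose two places lie BOTH in `T` (toward `T₀`) or BOTH in `c·(𝓗 ∖ T)` (toward `T₁`). [folklore] -/
theorem orbit_corner_face_cases (hm : 2 ≤ m) (T B : Finset G) (hTH : T ⊆ T₀.1 \ T₁.1) (hTm : T.card = m)
    (hB : B ⊆ T₀.1 \ (T₀.1 \ T₁.1)) (hBm : B.card < m) (X : CMF G c) (hX : T₀.1 \ X.1 = T ∪ B) :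
    ∃ s s' : G, s ≠ s' ∧ gface c hc2 X s s' ∈ L ∧
      ((s ∈ T ∧ s' ∈ T) ∨
        (s ∈ ((T₀.1 \ T₁.1) \ T).image (fun x => c * x) ∧ s' ∈ ((T₀.1 \ T₁.1) \ T).image (fun x => c * x))) := by
  obtain ⟨hbp, hcardD, hsdD⟩ := bpot_orbit_corner c hc2 hcen T₀ T₁ hbase m hn hH T B hTH hTm hB hBm X hX
  have hBdisj : Disjoint B (T₀.1 \ T₁.1) := by
    rw [disjoint_iff_ne]; rintro x hx y hy rfl; exact (mem_sdiff.mp (hB hx)).2 hy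
  have hTB : Disjoint T B := by
    rw [disjoint_iff_ne]; rintro x hx y hy rfl; exact (mem_sdiff.mp (hB hy)).2 (hTH hx)
  -- the corners of a face at two places of `T` have unique nearest base change `T₀`
  have hstrictT : ∀ t₁ ∈ T, ∀ t₂ ∈ T, t₁ ≠ t₂ →
      (∀ Q' : G, ddist (rt c Q' T₀) (oflipCM c hc2 t₁ X) = bpot c T₀ (oflipCM c hc2 t₁ X) → rt c Q' T₀ = rt c (1 : G) T₀) ∧
      (∀ Q' : G, ddist (rt c Q' T₀) (oflipCM c hc2 t₁ (oflipCM c hc2 t₂ X)) = bpot c T₀ (oflipCM c hc2 t₁ (oflipCM c hc2 t₂ X)) →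
        rt c Q' T₀ = rt c (1 : G) T₀) := by
    intro t₁ ht₁ t₂ ht₂ h12
    have ht₁D : t₁ ∈ T₀.1 \ X.1 := by rw [hX]; exact mem_union_left _ ht₁
    have ht₂D : t₂ ∈ T₀.1 \ X.1 := by rw [hX]; exact mem_union_left _ ht₂
    have hD1 : T₀.1 \ (oflipCM c hc2 t₁ X).1 = (T ∪ B).erase t₁ := by
      rw [dev_oflip c hc2 (mem_sdiff.mp ht₁D).1 (mem_sdiff.mp ht₁D).2, hX]
    have ht₁D' : t₁ ∈ T₀.1 \ (oflipCM c hc2 t₂ X).1 := by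
      rw [dev_oflip c hc2 (mem_sdiff.mp ht₂D).1 (mem_sdiff.mp ht₂D).2]; exact mem_erase.mpr ⟨h12, ht₁D⟩
    have hD12 : T₀.1 \ (oflipCM c hc2 t₁ (oflipCM c hc2 t₂ X)).1 = ((T ∪ B).erase t₂).erase t₁ := by
      rw [dev_oflip c hc2 (mem_sdiff.mp ht₁D').1 (mem_sdiff.mp ht₁D').2, dev_oflip c hc2 (mem_sdiff.mp ht₂D).1 (mem_sdiff.mp ht₂D).2, hX]
    refine ⟨(unique_T₀_below_orbit_corner c hc2 hcen T₀ T₁ hbase m hn hH T B hTH hTm hB hBm _ ?_ ?_).2,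
      (unique_T₀_below_orbit_corner c hc2 hcen T₀ T₁ hbase m hn hH T B hTH hTm hB hBm _ ?_ ?_).2⟩
    · rw [hD1]; exact erase_subset _ _
    · rw [hD1]; exact fun h => (notMem_erase t₁ _) (h ht₁)
    · rw [hD12]; exact (erase_subset _ _).trans (erase_subset _ _)
    · rw [hD12]; exact fun h => (notMem_erase t₁ _) (h ht₁)
  -- a strict lowering triple exists at `X`: two places of `T`
  have hex : ∃ Q₁ t t' : G, bpot c T₀ X = ddist (rt c Q₁ T₀) X ∧ t ∈ (rt c Q₁ T₀).1 \ X.1 ∧ t' ∈ (rt c Q₁ T₀).1 \ X.1 ∧ t ≠ t' ∧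
      (∀ Q' : G, ddist (rt c Q' T₀) (oflipCM c hc2 t X) = bpot c T₀ (oflipCM c hc2 t X) → rt c Q' T₀ = rt c Q₁ T₀) ∧
      (∀ Q' : G, ddist (rt c Q' T₀) (oflipCM c hc2 t' X) = bpot c T₀ (oflipCM c hc2 t' X) → rt c Q' T₀ = rt c Q₁ T₀) ∧
      (∀ Q' : G, ddist (rt c Q' T₀) (oflipCM c hc2 t (oflipCM c hc2 t' X)) = bpot c T₀ (oflipCM c hc2 t (oflipCM c hc2 t' X)) →
        rt c Q' T₀ = rt c Q₁ T₀) := by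
    obtain ⟨t₁, ht₁, t₂, ht₂, h12⟩ := one_lt_card.mp (by rw [hTm]; omega : 1 < T.card)
    refine ⟨1, t₁, t₂, by rw [rt_one, ddist_base_eq, hbp, hcardD], ?_, ?_, h12, (hstrictT t₁ ht₁ t₂ ht₂ h12).1,
      (hstrictT t₂ ht₂ t₁ ht₁ (Ne.symm h12)).1, (hstrictT t₁ ht₁ t₂ ht₂ h12).2⟩
    · rw [rt_one, hX]; exact mem_union_left _ ht₁
    · rw [rt_one, hX]; exact mem_union_left _ ht₂
  obtain ⟨Q₂, s, s', hQ₂, hs, hs', hss', hmem, hstr⟩ := hcover X (by rw [hbp]; omega)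
  obtain ⟨hu1, hu2, -⟩ := hstr hex
  -- the nearest base change used by the cover is `T₀` or `T₁`
  have hQ₂' : rt c Q₂ T₀ = T₀ ∨ rt c Q₂ T₀ = T₁ := by
    rcases hbase Q₂ with h | h | h | h
    · exact Or.inl h
    · exfalso; rw [h, ddist_compl_base_eq c T₀ hc2 hcen, hbp, hn, hcardD] at hQ₂; omega
    · exact Or.inr h
    · exfalso; rw [h, ddist_compl_eq c T₀ hc2 hcen, hbp, hn, hsdD] at hQ₂; omega
  refine ⟨s, s', hss', hmem, ?_⟩
  rcases hQ₂' with h0 | h1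
  · -- toward `T₀`: both places in `T` (a place of `B` would leave a tie corner)
    left
    rw [h0] at hs hs' hu1 hu2
    have hsD : s ∈ T ∪ B := hX ▸ hs
    have hs'D : s' ∈ T ∪ B := hX ▸ hs'
    refine ⟨?_, ?_⟩
    · rcases mem_union.mp hsD with h | h
      · exact h
      · exact (not_unique_orbit_corner_flip c hc2 hcen T₀ T₁ hbase m hn hH Q hQ (by omega) T B hTH hTm hB hBm X hX h _ hu1).elim
    · rcases mem_union.mp hs'D with h | h
      · exact h
      · exact (not_unique_orbit_corner_flip c hc2 hcen T₀ T₁ hbase m hn hH Q hQ (by omega) T B hTH hTm hB hBm X hX h _ hu2).elim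
  · -- toward `T₁`: both places in `c·(𝓗 ∖ T)`
    right
    rw [h1] at hs hs' hu1 hu2
    have hdev₁ : T₁.1 \ X.1 = B ∪ ((T₀.1 \ T₁.1) \ T).image (fun x => c * x) := by
      rw [sdiff_eq_of_dev c hc2 T₀ T₁ X, hX]
      congr 1
      · ext x; simp only [mem_sdiff, mem_union]
        constructor
        · rintro ⟨h | h, h'⟩
          · exact absurd (mem_sdiff.mp (hTH h)) h'
          · exact h
        · intro h; exact ⟨Or.inr h, fun h'' => (disjoint_left.mp hBdisj h) (mem_sdiff.mpr h'')⟩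
      · congr 1
        ext x; simp only [mem_sdiff, mem_union, not_or]
        constructor
        · rintro ⟨h, h', -⟩; exact ⟨h, h'⟩
        · rintro ⟨h, h'⟩; exact ⟨h, h', fun hb => (disjoint_right.mp hBdisj (mem_sdiff.mpr h)) hb⟩
    have hsD : s ∈ B ∪ ((T₀.1 \ T₁.1) \ T).image (fun x => c * x) := hdev₁ ▸ hs
    have hs'D : s' ∈ B ∪ ((T₀.1 \ T₁.1) \ T).image (fun x => c * x) := hdev₁ ▸ hs'
    refine ⟨?_, ?_⟩
    · rcases mem_union.mp hsD with h | h
      · exact (not_unique_orbit_corner_flip c hc2 hcen T₀ T₁ hbase m hn hH Q hQ (by omega) T B hTH hTm hB hBm X hX h _ hu1).elim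
      · exact h
    · rcases mem_union.mp hs'D with h | h
      · exact (not_unique_orbit_corner_flip c hc2 hcen T₀ T₁ hbase m hn hH Q hQ (by omega) T B hTH hTm hB hBm X hX h _ hu2).elim
      · exact h

/-! ## §4 THE DICHOTOMY: `[X] ≡ θ_{T₀}` or `[X] ≡ θ_{T₁}` at an orbit corner -/

include hcen hbase hn hH hQ hcover in
/-- **ORBIT CORNER DICHOTOMY.**  In the four-type frame (`T₀·Q⁻¹ = T₁`), for `X = {T ∣ B}` with `T ⊆ 𝓗`, `|T| = m ≥ 2`,
`B ⊆ T₀ ∖ 𝓗`, `|B| < m`, a strict lowering cover gives `[X] − θ_{T₀}(typeSum [X]) ∈ L` OR `[X] − θ_{T₁}(typeSum [X]) ∈ L`. [folklore] -/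
theorem single_sub_thetaG_mem_or_of_orbit_corner (hm : 2 ≤ m) (T B : Finset G) (hTH : T ⊆ T₀.1 \ T₁.1) (hTm : T.card = m)
    (hB : B ⊆ T₀.1 \ (T₀.1 \ T₁.1)) (hBm : B.card < m) (X : CMF G c) (hX : T₀.1 \ X.1 = T ∪ B) :
    Finsupp.single X 1 - thetaG c hc2 T₀ (typeSum G c (Finsupp.single X 1)) ∈ L ∨
      Finsupp.single X 1 - thetaG c hc2 T₁ (typeSum G c (Finsupp.single X 1)) ∈ L := by
  obtain ⟨s, s', hss', hmem, hcases⟩ := orbit_corner_face_cases c hc2 hcen T₀ T₁ hbase m hn hH Q hQ L hcover hm T B hTH hTm hB hBm X hX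
  rcases hcases with ⟨hsT, hs'T⟩ | ⟨hsI, hs'I⟩
  · left
    refine single_sub_thetaG_mem_orbit_corner_of_face c hc2 hcen T₀ T₁ hbase m hn hH L hcover T B hTH hTm hB hBm
      (fun Y hY => ?_) X ⟨by rw [hX], Or.inl hX⟩
    have hYX : Y = X := eq_of_dev_eq c T₀ (by rw [hY, hX])
    subst hYX
    exact ⟨s, s', hsT, hs'T, hss', hmem⟩
  · right
    -- the exchanged frame `(T₁; T₀, Q)`
    have hcov := cover_frame c hc2 T₀ L Q hcover
    simp only [hQ] at hcov
    have hH₁ : (T₁.1 \ T₀.1).card = 2 * m := by rw [card_sdiff_frame c hc2 T₀ T₁, hH]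
    set T' := ((T₀.1 \ T₁.1) \ T).image (fun x => c * x) with hT'def
    have hT'H : T' ⊆ T₁.1 \ T₀.1 := by
      intro x hx
      obtain ⟨u, hu, rfl⟩ := mem_image.mp hx
      obtain ⟨hu0, hu1⟩ := mem_sdiff.mp (mem_sdiff.mp hu).1
      exact mem_sdiff.mpr ⟨by by_contra h; exact hu1 ((T₁.2 u).mpr h), (T₀.2 u).mp hu0⟩
    have hT'm : T'.card = m := by
      rw [hT'def, card_image_of_injective _ (mul_right_injective c), card_sdiff_of_subset hTH, hH, hTm]; omega
    have hBdisj : Disjoint B (T₀.1 \ T₁.1) := by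
      rw [disjoint_iff_ne]; rintro x hx y hy rfl; exact (mem_sdiff.mp (hB hx)).2 hy
    have hB₁ : B ⊆ T₁.1 \ (T₁.1 \ T₀.1) := by
      intro b hb
      obtain ⟨hb0, hbH⟩ := mem_sdiff.mp (hB hb)
      have hb1 : b ∈ T₁.1 := by by_contra h; exact hbH (mem_sdiff.mpr ⟨hb0, h⟩)
      exact mem_sdiff.mpr ⟨hb1, fun h => (mem_sdiff.mp h).2 hb0⟩
    have hX₁ : T₁.1 \ X.1 = T' ∪ B := by
      rw [sdiff_eq_of_dev c hc2 T₀ T₁ X, hX, union_comm]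
      congr 1
      · rw [hT'def]; congr 1
        ext x; simp only [mem_sdiff, mem_union, not_or]
        constructor
        · rintro ⟨h, h', -⟩; exact ⟨h, h'⟩
        · rintro ⟨h, h'⟩; exact ⟨h, h', fun hb => (disjoint_right.mp hBdisj (mem_sdiff.mpr h)) hb⟩
      · ext x; simp only [mem_sdiff, mem_union]
        constructor
        · rintro ⟨h | h, h'⟩
          · exact absurd (mem_sdiff.mp (hTH h)) h'
          · exact h
        · intro h; exact ⟨Or.inr h, fun h'' => (disjoint_left.mp hBdisj h) (mem_sdiff.mpr h'')⟩
    refine single_sub_thetaG_mem_orbit_corner_of_face c hc2 hcen T₁ T₀ (base_cases_exchange c hbase hQ) m (card_frame c hc2 T₀ T₁ m hn) hH₁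
      L hcov T' B hT'H hT'm hB₁ hBm (fun Y hY => ?_) X ⟨by rw [hX₁], Or.inl hX₁⟩
    have hYX : Y = X := eq_of_dev_eq c T₁ (by rw [hY, hX₁])
    subst hYX
    exact ⟨s, s', hsI, hs'I, hss', hmem⟩

end Frame

end

end Summit.HodgeConjecture.CorCM.Census.CentralSquares
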